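import Summits.AtomisticToContinuum.FouriersLaw.Theorems.EmbeddedDrudeMourreAbelThermodynamicLimitFixedTimeOffsetMatchingOfLeaves
import Summits.AtomisticToContinuum.FouriersLaw.Theorems.EmbeddedDrudeMourreAbelThermodynamicLimitCentralWindowEnsembleEquivalence
import Summits.AtomisticToContinuum.FouriersLaw.Theorems.EmbeddedDrudeMourreAbelThermodynamicLimitDynamicalMatching

/-!
# Leaf (B₀) `stub_fixedTimeOffsetMatching` of S4, line `loomis-compact-horizon-witness` — PROVED
(crux `EmbeddedDrudeMourre.AbelThermodynamicLimit`, item stmt-AtomisticToContinuum-12596; `--supports` file proving the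
registered leaf `stub_fixedTimeOffsetMatching` VERBATIM; closes nothing)

**Per-offset fixed-time two-dynamics matching.** For `P = pinnedChain ω₂ lam β γ` (all `> 0`), `T > 0` (with DLR
uniqueness in the regular class, carried but not used), a regular witness `(μT, D)` — `μT` DLR at `T`, shift-invariant,
Buttà–Marchioro superstable; `D.carrier ⊆ bmGood`, `D` preserves `μT`, absolutely convergent correlations —, every
offset `x ∈ ℤ` and time `t > 0`, the equilibrium pair correlation of bond currents of the OPEN `N`-chain converges to
the infinite-volume one:

  `⟨j_{c_N}(0) j_{c_N + x}(t)⟩_{N,T} → ∫ j_0 · (j_x ∘ φ_t) dμT`   (`N → ∞`, `c_N = ⌊(N-1)/2⌋`).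

It is the composition (`stub_fixedTimeOffsetMatchingOfLeaves`, file `…FixedTimeOffsetMatchingOfLeaves`: truncation,
layer cake, severed-flow locality, severed → `D.flow`) of its two halves, both proved in the tree:

* STATIC (`stub_centralWindowEnsembleEquivalence`, file `…CentralWindowEnsembleEquivalence`): the central-window laws
  of the free-boundary Gibbs measures `gibbsMeasure N T`, read through the centred embedding, converge setwise to `μT`
  — one-dimensional equivalence of ensembles (free finite Gibbs measures are DLR in the bulk; window kernels forget
  bounded far boundary data uniformly, by the transfer operator; `N`-uniform one-site tails; tightness of
  shift-invariant states);
* DYNAMIC (`stub_centralWindowDynamicalMatching`, file `…DynamicalMatching`): at fixed `t` the open chain and the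
  severed Hamiltonian flow of the centred box agree in probability, uniformly in `N` — the two-dynamics light cone
  (second-order Dobrushin–Fritz iteration inward from the frozen/moving outer neighbours; quartic pinning makes the
  force Lipschitz constant grow only like `R`; `N`-uniform energy and momentum tails of the stationary path law).

With (C) `stub_anchoredCorrelationTails` (landed) this closes S4 `stub_fixedHorizonMatching` of the line through the
landed glue `stub_fixedHorizonMatchingOfDynamicalLeaves`. All statements proved; `[folklore]`. No definitions.
-/

noncomputable section

namespace Summit.AtomisticToContinuum.FouriersLaw.Theorems.AbelThermodynamicLimit.LoomisCompactHorizonWitness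

/-- **Registered leaf (B₀) `stub_fixedTimeOffsetMatching` of S4, line `loomis-compact-horizon-witness` — PER-OFFSET
FIXED-TIME TWO-DYNAMICS MATCHING** (see the module docstring): `⟨j_{c_N}(0) j_{c_N+x}(t)⟩_{N,T} → ∫ j_0 (j_x ∘ φ_t) dμT`
for a regular witness `(μT, D)`, every offset `x` and every `t > 0`. Static half + dynamic half + the landed reduction.
[folklore] -/
theorem stub_fixedTimeOffsetMatching :
    ∀ ω₂ lam β γ : ℝ, 0 < ω₂ → 0 < lam → 0 < β → 0 < γ → ∀ T : ℝ, 0 < T →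
      (∀ μ₁ μ₂ : MeasureTheory.Measure
            Literature.MathematicalPhysics.KineticTheory.HeatConduction.ChainConfig,
          (Literature.MathematicalPhysics.KineticTheory.HeatConduction.pinnedChain
                ω₂ lam β γ).IsChainGibbsMeasure T μ₁ →
          Literature.MathematicalPhysics.KineticTheory.HeatConduction.IsShiftInvariant μ₁ →
          (Literature.MathematicalPhysics.KineticTheory.HeatConduction.pinnedChain
                ω₂ lam β γ).HasSuperstabilityEstimate μ₁ →
          (Literature.MathematicalPhysics.KineticTheory.HeatConduction.pinnedChain
                ω₂ lam β γ).IsChainGibbsMeasure T μ₂ →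
          Literature.MathematicalPhysics.KineticTheory.HeatConduction.IsShiftInvariant μ₂ →
          (Literature.MathematicalPhysics.KineticTheory.HeatConduction.pinnedChain
                ω₂ lam β γ).HasSuperstabilityEstimate μ₂ → μ₁ = μ₂) →
      ∀ (μT : MeasureTheory.Measure
            Literature.MathematicalPhysics.KineticTheory.HeatConduction.ChainConfig)
        (D : Literature.MathematicalPhysics.KineticTheory.HeatConduction.InfiniteChainDynamics
          (Literature.MathematicalPhysics.KineticTheory.HeatConduction.pinnedChain ω₂ lam β γ)),
        (Literature.MathematicalPhysics.KineticTheory.HeatConduction.pinnedChain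
            ω₂ lam β γ).IsChainGibbsMeasure T μT →
        Literature.MathematicalPhysics.KineticTheory.HeatConduction.IsShiftInvariant μT →
        (Literature.MathematicalPhysics.KineticTheory.HeatConduction.pinnedChain
            ω₂ lam β γ).HasSuperstabilityEstimate μT →
        D.carrier ⊆ (Literature.MathematicalPhysics.KineticTheory.HeatConduction.pinnedChain
            ω₂ lam β γ).bmGood →
        D.PreservesMeasure μT →
        (∀ t : ℝ, D.HasAbsConvergentCorrelation μT t) →
        ∀ (x : ℤ) (t : ℝ), 0 < t →
          Filter.Tendsto (fun N : ℕ =>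
              if hN : 2 * x.natAbs + 2 ≤ N then
                ∫ z, (Literature.MathematicalPhysics.KineticTheory.HeatConduction.pinnedChain
                        ω₂ lam β γ).bondCurrent N ⟨(N - 1) / 2, by omega⟩ z *
                  (∫ y, (Literature.MathematicalPhysics.KineticTheory.HeatConduction.pinnedChain
                        ω₂ lam β γ).bondCurrent N ⟨((((N - 1) / 2 : ℕ) : ℤ) + x).toNat, by omega⟩ y
                    ∂((Literature.MathematicalPhysics.KineticTheory.HeatConduction.pinnedChain
                        ω₂ lam β γ).transitionKernel N T T t.toNNReal z))
                  ∂((Literature.MathematicalPhysics.KineticTheory.HeatConduction.pinnedChain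
                        ω₂ lam β γ).gibbsMeasure N T)
              else 0)
            Filter.atTop
            (nhds (∫ σ, (Literature.MathematicalPhysics.KineticTheory.HeatConduction.pinnedChain
                      ω₂ lam β γ).bondCurrentZ σ 0 *
              (Literature.MathematicalPhysics.KineticTheory.HeatConduction.pinnedChain
                      ω₂ lam β γ).bondCurrentZ (D.flow t σ) x ∂μT)) := by
  intro ω₂ lam β γ hω hl hβ hγ T hT _hUniq μT D hG hS hss hcar hPres hAC x t ht
  exact stub_fixedTimeOffsetMatchingOfLeaves ω₂ lam β γ hω hl hβ hγ T hT μT D hG hss hcar hPres hAC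
    (fun ι hι a n A hA hAd =>
      stub_centralWindowEnsembleEquivalence ω₂ lam β γ hω hl hβ hγ T hT μT hG hS ι hι a n A hA hAd)
    (stub_centralWindowDynamicalMatching ω₂ lam β γ hω hl hβ hγ T hT) x t ht

end Summit.AtomisticToContinuum.FouriersLaw.Theorems.AbelThermodynamicLimit.LoomisCompactHorizonWitness

end
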